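import Literature.AlgebraicGeometry.Resolution.SncStrata
import Literature.AlgebraicGeometry.Resolution.StalkIdealLemmas
import Literature.AlgebraicGeometry.Resolution.FlatSlicingCriterion
import Mathlib.AlgebraicGeometry.Properties
import HarnessLib

/-!
# The stalk data at the generic point of a curve of `V(J)` (CoP1, Prop. 4.4: "working above `η(i)`")

Topic: `Literature/AlgebraicGeometry/Resolution`. [CoP1] = Cossart–Piltant, J. Algebra 320
(2008), proof of Prop. 4.4, p. 10: "Working above the generic point `η(i)` of some one dimensional
component of `Σ(i)`, we have `J𝒪_{X(i),η(i)}` principal for `i >> 0`". The commutative algebra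
of that step (`NearPointColengthDropScheme.lean`) is stated at a point `η` with `𝓘_{Y,η} = 𝔪_η`
(the centre `Y` is the closure of `η`), `𝒪_{X,η}` two-dimensional, and `J_η` of finite colength.
PROVED here, these three inputs from the geometric hypotheses:

* `primeOfSpecializes_refl`, `stalkIdeal_vanishingIdeal_closure_self` — **at the generic point
  `η` of `Y = cl{η}`, `𝓘_{Y,η} = 𝔪_η`;**
* `spanFinrank_maximalIdeal_stalk_eq` — for `𝒪_{X,η}` regular, `emb.dim 𝒪_{X,η} = codim η`;
* `radical_stalkIdeal_eq_maximalIdeal_of_mem_maxPoints`,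
  `exists_pow_maximalIdeal_le_stalkIdeal_of_mem_maxPoints`,
  `isFiniteLength_quotient_stalkIdeal_of_mem_maxPoints` — **at a maximal point `η` of `V(J)`
  (the generic point of an irreducible component of `V(J)`), `J_η` is `𝔪_η`-primary, so
  `𝒪_{X,η}/J_η` has finite length.**

## Sources

* V. Cossart, O. Piltant, J. Algebra 320 (2008) 1051–1082, proof of Prop. 4.4, p. 10.
  [CossartPiltant2008]
* The Stacks Project, Tag 01J7 (points of `Spec 𝒪_{X,x}` = generizations). [StacksProject]
-/

noncomputable section

open CategoryTheory AlgebraicGeometry TopologicalSpace IsLocalRing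

namespace Literature.AlgebraicGeometry.Resolution

universe u

open Scheme.IdealSheafData

variable {X : Scheme.{u}}

/-! ## `𝓘_{Y,η} = 𝔪_η` at the generic point -/

/-- The prime of the trivial generisation `η ⤳ η` is the maximal ideal. [folklore] -/
theorem primeOfSpecializes_refl (η : X) :
    primeOfSpecializes (specializes_refl η) = maximalIdeal (X.presheaf.stalk η) := by
  change (maximalIdeal (X.presheaf.stalk η)).comap (X.presheaf.stalkSpecializes (specializes_refl η)).hom = _
  rw [TopCat.Presheaf.stalkSpecializes_refl]
  exact Ideal.comap_id _

/-- **At the generic point `η` of `Y = cl{η}` the ideal of `Y` is the maximal ideal: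
`𝓘_{Y,η} = 𝔪_η`.** [cite: StacksProject, Tag 01J7] -/
theorem stalkIdeal_vanishingIdeal_closure_self (η : X) :
    stalkIdeal (vanishingIdeal ⟨closure {η}, isClosed_closure⟩) η =
      maximalIdeal (X.presheaf.stalk η) := by
  rw [stalkIdeal_vanishingIdeal_closure (specializes_refl η), primeOfSpecializes_refl]

/-- The same for a closed subset given as the closure of `η`. [cite: StacksProject, Tag 01J7] -/
theorem stalkIdeal_vanishingIdeal_eq_maximalIdeal_of_closure_eq {Y : Closeds X} {η : X}
    (hY : (Y : Set X) = closure {η}) :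
    stalkIdeal (vanishingIdeal Y) η = maximalIdeal (X.presheaf.stalk η) := by
  have : Y = ⟨closure {η}, isClosed_closure⟩ := Closeds.ext hY
  rw [this]
  exact stalkIdeal_vanishingIdeal_closure_self η

/-! ## Embedding dimension at a point with regular local ring -/

/-- For a point with regular local ring, the embedding dimension of `𝒪_{X,η}` is `codim η`
(`dim 𝒪_{X,η} = coheight η`, Stacks 02IZ). [cite: StacksProject, Tag 02IZ] -/
theorem spanFinrank_maximalIdeal_stalk_eq (η : X) [IsRegularLocalRing (X.presheaf.stalk η)]
    {d : ℕ} (hd : Order.coheight η = d) :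
    (maximalIdeal (X.presheaf.stalk η)).spanFinrank = d := by
  have h := IsRegularLocalRing.spanFinrank_maximalIdeal (R := X.presheaf.stalk η)
  rw [ringKrullDim_stalk_eq_coheight, hd] at h
  exact_mod_cast h

/-! ## `J_η` is `𝔪_η`-primary at a maximal point of `V(J)` -/

/-- **At a maximal point `η` of `V(J)` the radical of `J_η` is `𝔪_η`**: `√(J_η) = I(V(J))_η`,
whose minimal primes are the primes of the maximal points of `V(J)` specializing to `η`, i.e.
of `η` alone. [cite: StacksProject, Tag 01J7] -/
theorem radical_stalkIdeal_eq_maximalIdeal_of_mem_maxPoints [IsLocallyNoetherian X]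
    {J : X.IdealSheafData} {η : X} (hη : η ∈ maxPoints (J.support : Set X)) :
    (stalkIdeal J η).radical = maximalIdeal (X.presheaf.stalk η) := by
  have hηZ : η ∈ (J.support : Set X) := (mem_maxPoints_iff.mp hη).1
  -- `√(J_η) = I(V(J))_η`
  have hK : (stalkIdeal J η).radical = stalkIdeal (vanishingIdeal J.support) η := by
    rw [Scheme.IdealSheafData.vanishingIdeal_support, stalkIdeal_radical]
  rw [hK]
  apply le_antisymm
  · refine (mem_support_iff_stalkIdeal_le _ η).mp ?_
    rw [← SetLike.mem_coe, coe_support_vanishingIdeal]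
    exact hηZ
  · -- every minimal prime of `I(V(J))_η` is `𝔪_η`
    have hmin : ∀ P ∈ (stalkIdeal (vanishingIdeal J.support) η).minimalPrimes,
        P = maximalIdeal (X.presheaf.stalk η) := by
      intro P hP
      obtain ⟨η', h', hη'Z, -, rfl⟩ := exists_isMax_of_mem_minimalPrimes hP
      obtain rfl : η' = η := (mem_maxPoints_iff.mp hη).2 η' hη'Z h'
      exact primeOfSpecializes_refl η'
    have hrad : (stalkIdeal (vanishingIdeal J.support) η).radical =
        stalkIdeal (vanishingIdeal J.support) η := by
      rw [← hK, Ideal.radical_idem]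
    calc maximalIdeal (X.presheaf.stalk η)
        ≤ sInf (stalkIdeal (vanishingIdeal J.support) η).minimalPrimes :=
          le_sInf fun P hP => (hmin P hP).ge
      _ = (stalkIdeal (vanishingIdeal J.support) η).radical := Ideal.sInf_minimalPrimes
      _ = _ := hrad

/-- Hence **`𝔪_η^N ⊆ J_η` for some `N`** (`J_η` is `𝔪_η`-primary). [cite: StacksProject, Tag 01J7] -/
theorem exists_pow_maximalIdeal_le_stalkIdeal_of_mem_maxPoints [IsLocallyNoetherian X]
    {J : X.IdealSheafData} {η : X} (hη : η ∈ maxPoints (J.support : Set X)) :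
    ∃ N : ℕ, maximalIdeal (X.presheaf.stalk η) ^ N ≤ stalkIdeal J η := by
  refine Ideal.exists_pow_le_of_le_radical_of_fg ?_ (IsNoetherian.noetherian _)
  rw [radical_stalkIdeal_eq_maximalIdeal_of_mem_maxPoints hη]

/-- And **`𝒪_{X,η}/J_η` has finite length** — the quantity `λ(𝒪_{X,η}/J_η)` of the termination
argument above `η(i)`. [cite: CossartPiltant2008, proof of Prop. 4.4] -/
theorem isFiniteLength_quotient_stalkIdeal_of_mem_maxPoints [IsLocallyNoetherian X]
    {J : X.IdealSheafData} {η : X} (hη : η ∈ maxPoints (J.support : Set X)) :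
    IsFiniteLength (X.presheaf.stalk η) (X.presheaf.stalk η ⧸ stalkIdeal J η) := by
  obtain ⟨N, hN⟩ := exists_pow_maximalIdeal_le_stalkIdeal_of_mem_maxPoints hη
  exact Matsumura1987.isFiniteLength_quotient_of_pow_le hN

end Literature.AlgebraicGeometry.Resolution

end
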